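import Mathlib
import HarnessLib

/-!
# Route `IntegerScrew` — the finite Markov semigroup `P_t = e^{tQ}`: forward equation, `P_0 = I`, and
# ENTRYWISE NON-NEGATIVITY for a Metzler generator (the kernel hypotheses of the transfer lemma 16.1)

The transfer lemma of THEOREM C♯ (CONTINUUM-LIMIT 16.1; tree file `IntegerScrewHarmonicTransfer`) is
stated for an abstract kernel row `s ↦ P s x₀ ·` that is non-negative, starts at `δ_{x₀}` and solves the
forward equation `∂_s P = P·Q`.  For a finite continuous-time Markov chain with generator `Q` (off-diagonal
entries `≥ 0`; for the walk of PROP. N4: `Q(k, kn) = Λ(n)/(nL)`, `Q(k, k/p^b) = log p/L`) the kernel is the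
matrix exponential `P_t = exp(tQ)`, and this file supplies exactly those three hypotheses:

* `hasDerivAt_exp_smul_apply` — `∂_t (e^{tQ})_{ij} = Σ_k (e^{tQ})_{ik} Q_{kj}` (Kolmogorov's forward equation,
  from Mathlib's `hasDerivAt_exp_smul_const` through the entry functional);
* `exp_zero_smul_apply` — `(e^{0·Q})_{ij} = δ_{ij}`; `continuous_exp_smul_apply`;
* `exp_smul_apply_nonneg` — **if `Q_{ij} ≥ 0` for `i ≠ j` and `t ≥ 0` then `(e^{tQ})_{ij} ≥ 0`**, via
  `e^{tQ} = e^{−λt}·e^{t(Q+λI)}` (`λ = Σ_k |Q_kk|`) with `Q + λI ≥ 0` entrywise and the exponential SERIES of a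
  non-negative matrix (`exp_apply_nonneg_of_nonneg`: powers and `∑' n, B^n/n!` are entrywise `≥ 0`, the sum
  read through the continuous entry functional).

Generic finite-dimensional linear algebra / analysis (the `L^∞`-operator norm on matrices is used only inside
proofs, via `open scoped Matrix.Norms.Operator`); RH-free and walk-free.  Nothing here bears on the truth of RH.
References: PIVOT-LAW §13.44, CONTINUUM-LIMIT §16.1 (rh-explicit, A6-PIVOT theory); M. Suzuki, J. Lond. Math.
Soc. (2) 108 (2023) 1448–1487 [Suzuki2023] for the screw matrices whose pivot law this serves.
-/

noncomputable section

-- D-0017: `Summit.<S>.<S>.…` is the designed namespace of a single-problem summit.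
set_option linter.dupNamespace false

namespace Summit.RiemannHypothesis.RiemannHypothesis.Theorems.IntegerScrew

open scoped Matrix.Norms.Operator
open NormedSpace Finset

variable {ι : Type*} [Fintype ι] [DecidableEq ι]

/-- Powers of an entrywise non-negative matrix are entrywise non-negative. -/
theorem pow_apply_nonneg_of_nonneg {B : Matrix ι ι ℝ} (hB : ∀ i j, 0 ≤ B i j) (n : ℕ) (i j : ι) :
    0 ≤ (B ^ n) i j := by
  induction n generalizing i j with
  | zero =>
    rw [pow_zero, Matrix.one_apply]
    split_ifs <;> norm_num
  | succ n ih =>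
    rw [pow_succ, Matrix.mul_apply]
    exact Finset.sum_nonneg fun k _ => mul_nonneg (ih i k) (hB k j)

/-- The exponential of an entrywise non-negative matrix is entrywise non-negative (series of non-negative
terms). -/
theorem exp_apply_nonneg_of_nonneg {B : Matrix ι ι ℝ} (hB : ∀ i j, 0 ≤ B i j) (i j : ι) :
    0 ≤ (exp B) i j := by
  let L : Matrix ι ι ℝ →L[ℝ] ℝ := LinearMap.toContinuousLinearMap (Matrix.entryLinearMap ℝ ℝ i j)
  have hL : ∀ A : Matrix ι ι ℝ, L A = A i j := fun A => rfl
  have hs : HasSum (fun n : ℕ => ((Nat.factorial n : ℝ)⁻¹ • B ^ n)) (exp B) :=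
    NormedSpace.exp_series_hasSum_exp' (𝕂 := ℝ) B
  have h2 := hs.map L L.continuous
  have h3 : 0 ≤ L (exp B) := by
    refine h2.nonneg fun n => ?_
    show 0 ≤ L ((Nat.factorial n : ℝ)⁻¹ • B ^ n)
    have e : L ((Nat.factorial n : ℝ)⁻¹ • B ^ n) = (Nat.factorial n : ℝ)⁻¹ * (B ^ n) i j :=
      (hL _).trans (by rw [Matrix.smul_apply, smul_eq_mul])
    rw [e]
    exact mul_nonneg (by positivity) (pow_apply_nonneg_of_nonneg hB n i j)
  exact h3

/-- **Entrywise non-negativity of the Markov semigroup.**  If `Q` is a Metzler matrix (`Q_{ij} ≥ 0` for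
`i ≠ j`) and `t ≥ 0`, then every entry of `exp(tQ)` is `≥ 0`. -/
theorem exp_smul_apply_nonneg {Q : Matrix ι ι ℝ} (hQ : ∀ i j, i ≠ j → 0 ≤ Q i j) {t : ℝ} (ht : 0 ≤ t)
    (i j : ι) : 0 ≤ (exp (t • Q)) i j := by
  -- shift: λ := Σ_k |Q_kk| dominates every −Q_ii
  set lam : ℝ := ∑ k, |Q k k| with hlam
  have hB : ∀ a b, 0 ≤ (t • (Q + lam • (1 : Matrix ι ι ℝ))) a b := by
    intro a b
    rw [Matrix.smul_apply, smul_eq_mul, Matrix.add_apply, Matrix.smul_apply, smul_eq_mul, Matrix.one_apply]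
    refine mul_nonneg ht ?_
    by_cases hab : a = b
    · subst hab
      rw [if_pos rfl, mul_one]
      have h1 : |Q a a| ≤ lam := by
        rw [hlam]
        exact Finset.single_le_sum (f := fun k => |Q k k|) (fun k _ => abs_nonneg _) (Finset.mem_univ a)
      have h2 : -Q a a ≤ |Q a a| := neg_le_abs _
      linarith
    · rw [if_neg hab, mul_zero, add_zero]
      exact hQ a b hab
  have hsplit : t • Q = t • (Q + lam • (1 : Matrix ι ι ℝ)) + (-(t * lam)) • (1 : Matrix ι ι ℝ) := by
    rw [smul_add, smul_smul, neg_smul, ← sub_eq_add_neg, add_sub_cancel_right]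
  have hcomm : Commute (t • (Q + lam • (1 : Matrix ι ι ℝ))) ((-(t * lam)) • (1 : Matrix ι ι ℝ)) :=
    ((Commute.one_right _).smul_right _)
  -- `exp(c·1) = e^c·1` (scalars pass through the exponential; cf. the tree's
  -- `Literature.Geometry.Kaehler.ComplexTorus.exp_smul_one_real`, not imported here to keep this file light)
  have hone : exp ((-(t * lam)) • (1 : Matrix ι ι ℝ)) = Real.exp (-(t * lam)) • (1 : Matrix ι ι ℝ) := by
    rw [Matrix.smul_one_eq_diagonal, Matrix.exp_diagonal, Matrix.smul_one_eq_diagonal]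
    congr 1
    funext k
    rw [Pi.coe_exp, ← Real.exp_eq_exp_ℝ]
  rw [hsplit, Matrix.exp_add_of_commute _ _ hcomm, hone, Matrix.mul_smul, mul_one,
    Matrix.smul_apply, smul_eq_mul]
  exact mul_nonneg (Real.exp_pos _).le (exp_apply_nonneg_of_nonneg hB i j)

/-- **Kolmogorov's forward equation, entrywise**: `∂_t (e^{tQ})_{ij} = Σ_k (e^{tQ})_{ik}·Q_{kj}`. -/
theorem hasDerivAt_exp_smul_apply (Q : Matrix ι ι ℝ) (t : ℝ) (i j : ι) :
    HasDerivAt (fun s : ℝ => (exp (s • Q)) i j) (∑ k, (exp (t • Q)) i k * Q k j) t := by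
  have h := hasDerivAt_exp_smul_const (𝕂 := ℝ) Q t
  let L : Matrix ι ι ℝ →L[ℝ] ℝ := LinearMap.toContinuousLinearMap (Matrix.entryLinearMap ℝ ℝ i j)
  have hL : ∀ A : Matrix ι ι ℝ, L A = A i j := fun A => rfl
  have h2 := L.hasFDerivAt.comp_hasDerivAt t h
  have hfun : (fun s : ℝ => (exp (s • Q)) i j) = (L : Matrix ι ι ℝ → ℝ) ∘ fun u : ℝ => exp (u • Q) := by
    funext s
    simp only [Function.comp_apply, hL]
  rw [hfun]
  refine h2.congr_deriv ?_
  exact (hL _).trans Matrix.mul_apply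

/-- `t ↦ (e^{tQ})_{ij}` is continuous. -/
theorem continuous_exp_smul_apply (Q : Matrix ι ι ℝ) (i j : ι) :
    Continuous fun s : ℝ => (exp (s • Q)) i j :=
  continuous_iff_continuousAt.2 fun t => (hasDerivAt_exp_smul_apply Q t i j).continuousAt

/-- `(e^{0·Q})_{ij} = δ_{ij}`. -/
theorem exp_zero_smul_apply (Q : Matrix ι ι ℝ) (i j : ι) :
    (exp ((0 : ℝ) • Q)) i j = if j = i then 1 else 0 := by
  rw [zero_smul, NormedSpace.exp_zero, Matrix.one_apply]
  by_cases h : i = j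
  · subst h; simp
  · rw [if_neg h, if_neg (Ne.symm h)]

end Summit.RiemannHypothesis.RiemannHypothesis.Theorems.IntegerScrew

end
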